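/-
Copyright (c) 2026. All rights reserved.
Released under Apache 2.0 license as described in the file LICENSE.
Authors: abc-iut cell, campaign-S prover seat abc-iut-S1 (gen 2).
-/
import Mathlib.RingTheory.PiTensorProduct
import Mathlib.LinearAlgebra.Pi
import Mathlib.Algebra.Group.Subgroup.Finite
import Mathlib.Algebra.Module.Submodule.Lattice
import HarnessLib

/-!
# Restriction of scalars for finite tensor products: `⨂_{i,R} M_i → ⨂_{i,S} M_i`

Topic `LinearAlgebra/BaseChange`; namespace `Literature.LinearAlgebra.BaseChange`. Mathlib-gap file
(Mathlib has the binary `TensorProduct.mapOfCompatibleSMul : M ⊗[A] N →ₗ[A] M ⊗[R] N` but no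
`PiTensorProduct` analogue at the pinned version).

For a commutative `R`-algebra `S` and `S`-modules `M_i` (hence `R`-modules, `IsScalarTower R S (M i)`):

* `piTensorRestrictScalars R S M : (⨂[R] i, M i) →ₗ[R] ⨂[S] i, M i`, `⊗_R x_i ↦ ⊗_S x_i` — the
  canonical comparison map from the tensor product over the SMALL ring to the tensor product over the
  BIG ring (Bourbaki, *Algebra* II §3 no. 9, change of base ring: the canonical surjection
  `E ⊗_A F → E ⊗_B F` for a ring map `A → B`);
* `piTensorRestrictScalars_surjective`: it is SURJECTIVE as soon as the index type is nonempty
  (absorb the `S`-scalar of `s • ⊗ x_i` into one slot);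
* `piTensorRestrictScalarsAlgHom`: for commutative `S`-algebras `A_i` it is an `R`-algebra map;
* the DISTRIBUTED form over finite products, `piTensorDistrib R S M :
  (⨂[R] a, Π v, M a v) →ₗ[R] Π (v⃗ : α → V), ⨂[S] a, M a (v⃗ a)`, `⊗_a x_a ↦ (v⃗ ↦ ⊗_a x_a(v⃗ a))`
  (`⊗` distributes over finite `⊕`, then restriction of scalars summandwise), SURJECTIVE for nonempty
  finite `α` (`piTensorDistrib_surjective`);
* IMAGE LEMMAS: the additive closure / `R`-span of the pure tensors with slots in prescribed subsets
  `T_i ⊆ M_i` is mapped ONTO the corresponding closure on the `S`-side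
  (`map_closure_tprodMem`, `map_span_tprodMem`), and, in the distributed form with `0 ∈ T_{a,v}`, ONTO the
  product over `v⃗` of the summand closures (`piTensorDistrib_map_closure_tprodMem`).

Motivation (no dependence): the tensor packets of [IUTchIII] Prop. 3.1/3.2 are typed in the tree over
`ℚ` (`⨂[ℚ]` of finite direct sums of `p`-adic fields) while the log-volume computations of [IUTchIV] §1
live on `⨂[ℚ_p]`; this file is the algebra of the comparison.

## References (locators read on the page of the held text `book:bourbakind-algebra`)

* N. Bourbaki, *Algebra I, Chapters 1–3*, Springer 1989 [BourbakiAlgebraI1989]: Ch. II §3 no. 3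
  Prop. 2 ("CHANGE OF RING": for `ρ : B → A` the canonical `ℤ`-linear map
  `ρ_*(E) ⊗_B ρ_*(F) → E ⊗_A F`, `x ⊗ y ↦ x ⊗ y`, "this ℤ-linear mapping is surjective") — here in
  the `n`-fold form of Ch. II §3 no. 9; Ch. II §3 no. 7, the canonical map (22)
  `(Π E_λ) ⊗ (Π F_μ) → Π (E_λ ⊗ F_μ)` of "TENSOR PRODUCTS OF PRODUCTS AND DIRECT SUMS" — here `n`-fold
  and followed by the change of ring.
-/

noncomputable section

open PiTensorProduct Function
open scoped TensorProduct

namespace Literature.LinearAlgebra.BaseChange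

universe uR uS uι uM uα uV

/-! ## 1. The comparison map `θ : ⨂_R M_i → ⨂_S M_i` -/

section Module

variable (R : Type uR) (S : Type uS) [CommSemiring R] [CommSemiring S] [Algebra R S]
variable {ι : Type uι} (M : ι → Type uM) [∀ i, AddCommMonoid (M i)] [∀ i, Module S (M i)]
  [∀ i, Module R (M i)] [∀ i, IsScalarTower R S (M i)]

/-- The pure tensors `⊗_R x_i` with every slot `x_i` in a prescribed subset `T_i ⊆ M_i`. [cite: BourbakiAlgebraI1989, Ch. II §3 no. 3 Prop. 2] -/
def tprodMem (T : ∀ i, Set (M i)) : Set (⨂[R] i, M i) :=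
  {z | ∃ x : ∀ i, M i, (∀ i, x i ∈ T i) ∧ z = tprod R x}

omit [Algebra R S] [∀ i, Module S (M i)] [∀ i, IsScalarTower R S (M i)] in
/-- A pure tensor with slots in `T` lies in `tprodMem R M T`. [cite: BourbakiAlgebraI1989, Ch. II §3 no. 3 Prop. 2] -/
theorem tprod_mem_tprodMem {T : ∀ i, Set (M i)} {x : ∀ i, M i} (hx : ∀ i, x i ∈ T i) :
    tprod R x ∈ tprodMem R M T :=
  ⟨x, hx, rfl⟩

/-- **The comparison map** `θ : ⨂_{i,R} M_i → ⨂_{i,S} M_i`, `⊗_R x_i ↦ ⊗_S x_i`, for `S`-modules `M_i`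
over an `R`-algebra `S` (restriction of scalars of the universal `S`-multilinear map). [cite: BourbakiAlgebraI1989, Ch. II §3 no. 3 Prop. 2] -/
def piTensorRestrictScalars : (⨂[R] i, M i) →ₗ[R] ⨂[S] i, M i :=
  PiTensorProduct.lift ((PiTensorProduct.tprod S : MultilinearMap S M (⨂[S] i, M i)).restrictScalars R)

/-- `θ (⊗_R x_i) = ⊗_S x_i`. [cite: BourbakiAlgebraI1989, Ch. II §3 no. 3 Prop. 2] -/
@[simp]
theorem piTensorRestrictScalars_tprod (x : ∀ i, M i) :
    piTensorRestrictScalars R S M (tprod R x) = tprod S x := by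
  rw [piTensorRestrictScalars, PiTensorProduct.lift.tprod, MultilinearMap.coe_restrictScalars]

/-- An `S`-multiple of a pure tensor is a pure tensor (absorb the scalar into the slot `i₀`).
[cite: BourbakiAlgebraI1989, Ch. II §3 no. 3 Prop. 2] -/
theorem smul_tprod_eq_tprod_update [DecidableEq ι] (i₀ : ι) (r : S) (f : ∀ i, M i) :
    r • tprod S f = tprod S (update f i₀ (r • f i₀)) := by
  have h := (PiTensorProduct.tprod S : MultilinearMap S M (⨂[S] i, M i)).map_update_smul f i₀ r (f i₀)
  rw [update_eq_self] at h
  exact h.symm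

/-- **Surjectivity of the comparison map** for a nonempty index type: every element of `⨂_S M_i` is a
finite sum of pure tensors `⊗_S x_i` (the `S`-scalars being absorbed into one slot), each of which is
`θ (⊗_R x_i)`. (For `ι = ∅` the map is `algebraMap R S`, not surjective in general.) [cite: BourbakiAlgebraI1989, Ch. II §3 no. 3 Prop. 2] -/
theorem piTensorRestrictScalars_surjective [Nonempty ι] :
    Function.Surjective (piTensorRestrictScalars R S M) := by
  classical
  obtain ⟨i₀⟩ := ‹Nonempty ι›
  intro z
  induction z using PiTensorProduct.induction_on with
  | smul_tprod r f =>
    exact ⟨tprod R (update f i₀ (r • f i₀)), by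
      rw [piTensorRestrictScalars_tprod, smul_tprod_eq_tprod_update S M i₀]⟩
  | add x y hx hy =>
    obtain ⟨a, rfl⟩ := hx
    obtain ⟨b, rfl⟩ := hy
    exact ⟨a + b, map_add _ _ _⟩

/-- The comparison map has full range (nonempty index type). [cite: BourbakiAlgebraI1989, Ch. II §3 no. 3 Prop. 2] -/
theorem range_piTensorRestrictScalars [Nonempty ι] :
    LinearMap.range (piTensorRestrictScalars R S M) = ⊤ :=
  LinearMap.range_eq_top.mpr (piTensorRestrictScalars_surjective R S M)

/-- `θ` maps the pure tensors with slots in `T` ONTO the pure tensors with slots in `T`. [cite: BourbakiAlgebraI1989, Ch. II §3 no. 3 Prop. 2] -/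
theorem image_tprodMem (T : ∀ i, Set (M i)) :
    piTensorRestrictScalars R S M '' tprodMem R M T = tprodMem S M T := by
  ext z
  constructor
  · rintro ⟨_, ⟨x, hx, rfl⟩, rfl⟩
    exact ⟨x, hx, piTensorRestrictScalars_tprod R S M x⟩
  · rintro ⟨x, hx, rfl⟩
    exact ⟨tprod R x, ⟨x, hx, rfl⟩, piTensorRestrictScalars_tprod R S M x⟩

/-- **Image of the additive closure of pure tensors**: `θ` maps the additive submonoid generated by the
`⊗_R x_i`, `x_i ∈ T_i`, ONTO the additive submonoid generated by the `⊗_S x_i`, `x_i ∈ T_i`.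
[cite: BourbakiAlgebraI1989, Ch. II §3 no. 3 Prop. 2] -/
theorem map_mclosure_tprodMem (T : ∀ i, Set (M i)) :
    (AddSubmonoid.closure (tprodMem R M T)).map (piTensorRestrictScalars R S M).toAddMonoidHom =
      AddSubmonoid.closure (tprodMem S M T) := by
  rw [AddMonoidHom.map_mclosure]
  exact congrArg _ (image_tprodMem R S M T)

/-- **Image of the `R`-span of pure tensors**: `θ` maps `span_R {⊗_R x_i : x_i ∈ T_i}` ONTO
`span_R {⊗_S x_i : x_i ∈ T_i}`. [cite: BourbakiAlgebraI1989, Ch. II §3 no. 3 Prop. 2] -/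
theorem map_span_tprodMem (T : ∀ i, Set (M i)) :
    (Submodule.span R (tprodMem R M T)).map (piTensorRestrictScalars R S M) =
      Submodule.span R (tprodMem S M T) := by
  rw [Submodule.map_span]
  exact congrArg _ (image_tprodMem R S M T)

end Module

section Group

variable (R : Type uR) (S : Type uS) [CommRing R] [CommRing S] [Algebra R S]
variable {ι : Type uι} (M : ι → Type uM) [∀ i, AddCommGroup (M i)] [∀ i, Module S (M i)]
  [∀ i, Module R (M i)] [∀ i, IsScalarTower R S (M i)]

/-- **Image of the additive subgroup generated by pure tensors** (the form in which lattices such as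
`R_I = ⊗_{ℤ_p} R_i ⊆ ⊗_{ℚ_p} k_i` are presented): `θ` maps the subgroup generated by the `⊗_R x_i`,
`x_i ∈ T_i`, ONTO the subgroup generated by the `⊗_S x_i`, `x_i ∈ T_i`. [cite: BourbakiAlgebraI1989, Ch. II §3 no. 3 Prop. 2] -/
theorem map_closure_tprodMem (T : ∀ i, Set (M i)) :
    (AddSubgroup.closure (tprodMem R M T)).map (piTensorRestrictScalars R S M).toAddMonoidHom =
      AddSubgroup.closure (tprodMem S M T) := by
  rw [AddMonoidHom.map_closure]
  exact congrArg _ (image_tprodMem R S M T)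

end Group

/-! ## 2. Algebra version -/

section Algebra

variable (R : Type uR) (S : Type uS) [CommSemiring R] [CommSemiring S] [Algebra R S]
variable {ι : Type uι} (A : ι → Type uM) [∀ i, CommSemiring (A i)] [∀ i, Algebra S (A i)]
  [∀ i, Algebra R (A i)] [∀ i, IsScalarTower R S (A i)]

/-- For commutative `S`-algebras `A_i` the comparison map `⨂_R A_i → ⨂_S A_i` is a homomorphism of
`R`-algebras (`⊗1 = 1`, `⊗x · ⊗y = ⊗(xy)` on both sides). [cite: BourbakiAlgebraI1989, Ch. II §3 no. 3 Prop. 2] -/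
def piTensorRestrictScalarsAlgHom : (⨂[R] i, A i) →ₐ[R] ⨂[S] i, A i :=
  PiTensorProduct.liftAlgHom
    ((PiTensorProduct.tprod S : MultilinearMap S A (⨂[S] i, A i)).restrictScalars R)
    (by rw [MultilinearMap.coe_restrictScalars, ← PiTensorProduct.one_def])
    (fun x y ↦ by simp only [MultilinearMap.coe_restrictScalars, PiTensorProduct.tprod_mul_tprod])

/-- The algebra version has the same underlying linear map. [cite: BourbakiAlgebraI1989, Ch. II §3 no. 3 Prop. 2] -/
theorem piTensorRestrictScalarsAlgHom_toLinearMap :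
    (piTensorRestrictScalarsAlgHom R S A).toLinearMap = piTensorRestrictScalars R S A :=
  rfl

/-- `θ (⊗_R x_i) = ⊗_S x_i` (algebra version). [cite: BourbakiAlgebraI1989, Ch. II §3 no. 3 Prop. 2] -/
@[simp]
theorem piTensorRestrictScalarsAlgHom_tprod (x : ∀ i, A i) :
    piTensorRestrictScalarsAlgHom R S A (tprod R x) = tprod S x := by
  rw [← AlgHom.toLinearMap_apply, piTensorRestrictScalarsAlgHom_toLinearMap,
    piTensorRestrictScalars_tprod]

/-- The algebra version is surjective (nonempty index type). [cite: BourbakiAlgebraI1989, Ch. II §3 no. 3 Prop. 2] -/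
theorem piTensorRestrictScalarsAlgHom_surjective [Nonempty ι] :
    Function.Surjective (piTensorRestrictScalarsAlgHom R S A) := by
  intro z
  obtain ⟨a, ha⟩ := piTensorRestrictScalars_surjective R S A z
  exact ⟨a, by rw [← AlgHom.toLinearMap_apply, piTensorRestrictScalarsAlgHom_toLinearMap, ha]⟩

end Algebra

/-! ## 3. The distributed form over finite products -/

section Distribute

variable (R : Type uR) (S : Type uS) [CommSemiring R] [CommSemiring S] [Algebra R S]
variable {α : Type uα} {V : Type uV}
variable (M : α → V → Type uM) [∀ a v, AddCommMonoid (M a v)] [∀ a v, Module S (M a v)]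
  [∀ a v, Module R (M a v)] [∀ a v, IsScalarTower R S (M a v)]

/-- **The distributed comparison map** `e : ⨂_{a,R} (Π_v M_{a,v}) → Π_{v⃗ : α → V} ⨂_{a,S} M_{a,v⃗(a)}`,
`⊗_a x_a ↦ (v⃗ ↦ ⊗_{a,S} x_a(v⃗ a))`: project every factor to its `v⃗(a)`-component, then restrict
scalars (`⊗` distributes over finite direct sums — Mathlib `PiTensorProduct.ofDirectSumEquiv` — and
`θ` is applied summandwise). [cite: BourbakiAlgebraI1989, Ch. II §3 no. 7 (22)] -/
def piTensorDistrib : (⨂[R] a, (∀ v, M a v)) →ₗ[R] ∀ vA : α → V, ⨂[S] a, M a (vA a) :=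
  LinearMap.pi fun vA ↦
    piTensorRestrictScalars R S (fun a ↦ M a (vA a)) ∘ₗ
      PiTensorProduct.map fun a ↦ (LinearMap.proj (vA a) : (∀ v, M a v) →ₗ[R] M a (vA a))

/-- `e (⊗_a x_a) v⃗ = ⊗_{a,S} x_a(v⃗ a)`. [cite: BourbakiAlgebraI1989, Ch. II §3 no. 7 (22)] -/
@[simp]
theorem piTensorDistrib_tprod (x : ∀ a, ∀ v, M a v) (vA : α → V) :
    piTensorDistrib R S M (tprod R x) vA = tprod S fun a ↦ x a (vA a) := by
  simp [piTensorDistrib, PiTensorProduct.map_tprod]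

/-- The pure tensors with slots in `T_{a,v}` are mapped by `e` INTO the product of the summand
generating sets. [cite: BourbakiAlgebraI1989, Ch. II §3 no. 7 (22)] -/
theorem piTensorDistrib_tprodMem_subset (T : ∀ a v, Set (M a v)) {z : ⨂[R] a, (∀ v, M a v)}
    (hz : z ∈ tprodMem R (fun a ↦ ∀ v, M a v) fun a ↦ {x | ∀ v, x v ∈ T a v}) (vA : α → V) :
    piTensorDistrib R S M z vA ∈ tprodMem S (fun a ↦ M a (vA a)) fun a ↦ T a (vA a) := by
  obtain ⟨x, hx, rfl⟩ := hz
  exact ⟨fun a ↦ x a (vA a), fun a ↦ hx a (vA a), piTensorDistrib_tprod R S M x vA⟩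

variable [DecidableEq V]

/-- On the pure tensor of a family of `Pi.single`s concentrated along `v⃗`, `e` is the element of the
product concentrated at `v⃗`: `e (⊗_a δ_{v⃗ a}(y_a)) = δ_{v⃗}(⊗_S y_a)`. [cite: BourbakiAlgebraI1989, Ch. II §3 no. 7 (22)] -/
theorem piTensorDistrib_tprod_single [Fintype α] (vA : α → V) (y : ∀ a, M a (vA a)) :
    piTensorDistrib R S M (tprod R fun a ↦ (Pi.single (vA a) (y a) : ∀ v, M a v)) =
      Pi.single vA (tprod S y) := by
  funext vB
  rw [piTensorDistrib_tprod]
  by_cases h : vB = vA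
  · subst h
    simp
  · rw [Pi.single_eq_of_ne h]
    obtain ⟨a, ha⟩ : ∃ a, vB a ≠ vA a := Function.ne_iff.mp h
    exact (PiTensorProduct.tprod S).map_coord_zero a (by simp [Pi.single_eq_of_ne ha])

/-- **Surjectivity of the distributed comparison map** for a nonempty finite factor index `α`: every
element of `Π_{v⃗} ⨂_S M_{a,v⃗ a}` is a finite sum of elements concentrated at one `v⃗`, and those are
sums of `e`-images of pure tensors of `Pi.single`s. [cite: BourbakiAlgebraI1989, Ch. II §3 no. 7 (22)] -/
theorem piTensorDistrib_surjective [Fintype α] [Nonempty α] [Fintype V] :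
    Function.Surjective (piTensorDistrib R S M) := by
  classical
  obtain ⟨a₀⟩ := ‹Nonempty α›
  have hsingle : ∀ (vA : α → V) (w : ⨂[S] a, M a (vA a)),
      Pi.single vA w ∈ LinearMap.range (piTensorDistrib R S M) := by
    intro vA w
    induction w using PiTensorProduct.induction_on with
    | smul_tprod r y =>
      rw [smul_tprod_eq_tprod_update S (fun a ↦ M a (vA a)) a₀ r y,
        ← piTensorDistrib_tprod_single R S M vA]
      exact LinearMap.mem_range_self _ _
    | add x y hx hy =>
      rw [Pi.single_add]
      exact add_mem hx hy
  intro z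
  have hz : z ∈ LinearMap.range (piTensorDistrib R S M) := by
    rw [← Finset.univ_sum_single z]
    exact Submodule.sum_mem _ fun vA _ ↦ hsingle vA (z vA)
  exact hz

/-- **Image of the additive closure of pure tensors under the distributed map**: if `0 ∈ T_{a,v}` for
all `a, v`, then `e` maps the additive submonoid generated by the pure tensors `⊗_a x_a` with
`x_a(v) ∈ T_{a,v}` ONTO the product over `v⃗` of the submonoids generated by the `⊗_S y_a`,
`y_a ∈ T_{a,v⃗ a}` (the element concentrated at `v⃗` with value `⊗_S y_a` is `e (⊗_a δ_{v⃗ a}(y_a))`,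
whose off-diagonal slots are `0 ∈ T`). [cite: BourbakiAlgebraI1989, Ch. II §3 no. 7 (22)] -/
theorem piTensorDistrib_map_mclosure_tprodMem [Fintype α] [Fintype V] (T : ∀ a v, Set (M a v))
    (hT : ∀ a v, (0 : M a v) ∈ T a v) :
    (AddSubmonoid.closure (tprodMem R (fun a ↦ ∀ v, M a v) fun a ↦ {x | ∀ v, x v ∈ T a v})).map
        (piTensorDistrib R S M).toAddMonoidHom =
      AddSubmonoid.pi Set.univ fun vA : α → V ↦
        AddSubmonoid.closure (tprodMem S (fun a ↦ M a (vA a)) fun a ↦ T a (vA a)) := by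
  classical
  apply le_antisymm
  · rw [AddMonoidHom.map_mclosure, AddSubmonoid.closure_le]
    rintro _ ⟨z, hz, rfl⟩ vA -
    exact AddSubmonoid.subset_closure (piTensorDistrib_tprodMem_subset R S M T hz vA)
  · intro f hf
    rw [← Finset.univ_sum_single f]
    refine AddSubmonoid.sum_mem _ fun vA _ ↦ ?_
    have hfv : f vA ∈ AddSubmonoid.closure (tprodMem S (fun a ↦ M a (vA a)) fun a ↦ T a (vA a)) :=
      hf vA (Set.mem_univ _)
    revert hfv
    generalize f vA = w
    intro hfv
    induction hfv using AddSubmonoid.closure_induction with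
    | mem w hw =>
      obtain ⟨y, hy, rfl⟩ := hw
      rw [← piTensorDistrib_tprod_single R S M vA]
      refine ⟨tprod R _, AddSubmonoid.subset_closure ⟨_, fun a v ↦ ?_, rfl⟩, rfl⟩
      by_cases h : v = vA a
      · subst h; simpa using hy a
      · simp only [Pi.single_eq_of_ne h]; exact hT a v
    | zero => rw [Pi.single_zero]; exact zero_mem _
    | add x y _ _ hx hy => rw [Pi.single_add]; exact add_mem hx hy

end Distribute

section DistributeGroup

variable (R : Type uR) (S : Type uS) [CommRing R] [CommRing S] [Algebra R S]
variable {α : Type uα} {V : Type uV} [DecidableEq V]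
variable (M : α → V → Type uM) [∀ a v, AddCommGroup (M a v)] [∀ a v, Module S (M a v)]
  [∀ a v, Module R (M a v)] [∀ a v, IsScalarTower R S (M a v)]

/-- **Image of the additive subgroup generated by pure tensors under the distributed map** (the form
of the integral structures `𝓘(^{A}𝒟^⊢_{v_ℚ})` "by forming suitable direct sums and tensor products"):
with `0 ∈ T_{a,v}`, `e` maps the subgroup generated by the `⊗_a x_a`, `x_a(v) ∈ T_{a,v}`, ONTO the
product over `v⃗` of the subgroups generated by the `⊗_S y_a`, `y_a ∈ T_{a,v⃗ a}`. [cite: BourbakiAlgebraI1989, Ch. II §3 no. 7 (22)] -/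
theorem piTensorDistrib_map_closure_tprodMem [Fintype α] [Fintype V] (T : ∀ a v, Set (M a v))
    (hT : ∀ a v, (0 : M a v) ∈ T a v) :
    (AddSubgroup.closure (tprodMem R (fun a ↦ ∀ v, M a v) fun a ↦ {x | ∀ v, x v ∈ T a v})).map
        (piTensorDistrib R S M).toAddMonoidHom =
      AddSubgroup.pi Set.univ fun vA : α → V ↦
        AddSubgroup.closure (tprodMem S (fun a ↦ M a (vA a)) fun a ↦ T a (vA a)) := by
  classical
  apply le_antisymm
  · rw [AddMonoidHom.map_closure, AddSubgroup.closure_le]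
    rintro _ ⟨z, hz, rfl⟩ vA -
    exact AddSubgroup.subset_closure (piTensorDistrib_tprodMem_subset R S M T hz vA)
  · intro f hf
    rw [← Finset.univ_sum_single f]
    refine AddSubgroup.sum_mem _ fun vA _ ↦ ?_
    have hfv : f vA ∈ AddSubgroup.closure (tprodMem S (fun a ↦ M a (vA a)) fun a ↦ T a (vA a)) :=
      hf vA (Set.mem_univ _)
    revert hfv
    generalize f vA = w
    intro hfv
    induction hfv using AddSubgroup.closure_induction with
    | mem w hw =>
      obtain ⟨y, hy, rfl⟩ := hw
      rw [← piTensorDistrib_tprod_single R S M vA]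
      refine ⟨tprod R _, AddSubgroup.subset_closure ⟨_, fun a v ↦ ?_, rfl⟩, rfl⟩
      by_cases h : v = vA a
      · subst h; simpa using hy a
      · simp only [Pi.single_eq_of_ne h]; exact hT a v
    | zero => rw [Pi.single_zero]; exact zero_mem _
    | add x y _ _ hx hy => rw [Pi.single_add]; exact add_mem hx hy
    | neg x _ hx => rw [Pi.single_neg]; exact neg_mem hx

/-- The `R`-span version: with `0 ∈ T_{a,v}`, `e` maps `span_R {⊗_a x_a : x_a(v) ∈ T_{a,v}}` ONTO
`Π_{v⃗} span_R {⊗_S y_a : y_a ∈ T_{a,v⃗ a}}`. [cite: BourbakiAlgebraI1989, Ch. II §3 no. 7 (22)] -/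
theorem piTensorDistrib_map_span_tprodMem [Fintype α] [Fintype V] (T : ∀ a v, Set (M a v))
    (hT : ∀ a v, (0 : M a v) ∈ T a v) :
    (Submodule.span R (tprodMem R (fun a ↦ ∀ v, M a v) fun a ↦ {x | ∀ v, x v ∈ T a v})).map
        (piTensorDistrib R S M) =
      Submodule.pi Set.univ fun vA : α → V ↦
        Submodule.span R (tprodMem S (fun a ↦ M a (vA a)) fun a ↦ T a (vA a)) := by
  classical
  apply le_antisymm
  · rw [Submodule.map_span, Submodule.span_le]
    rintro _ ⟨z, hz, rfl⟩ vA -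
    exact Submodule.subset_span (piTensorDistrib_tprodMem_subset R S M T hz vA)
  · intro f hf
    rw [← Finset.univ_sum_single f]
    refine Submodule.sum_mem _ fun vA _ ↦ ?_
    have hfv : f vA ∈ Submodule.span R (tprodMem S (fun a ↦ M a (vA a)) fun a ↦ T a (vA a)) :=
      hf vA (Set.mem_univ _)
    revert hfv
    generalize f vA = w
    intro hfv
    induction hfv using Submodule.span_induction with
    | mem w hw =>
      obtain ⟨y, hy, rfl⟩ := hw
      rw [← piTensorDistrib_tprod_single R S M vA]
      refine ⟨tprod R _, Submodule.subset_span ⟨_, fun a v ↦ ?_, rfl⟩, rfl⟩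
      by_cases h : v = vA a
      · subst h; simpa using hy a
      · simp only [Pi.single_eq_of_ne h]; exact hT a v
    | zero => rw [Pi.single_zero]; exact zero_mem _
    | add x y _ _ hx hy => rw [Pi.single_add]; exact add_mem hx hy
    | smul r x _ hx => rw [Pi.single_smul]; exact Submodule.smul_mem _ r hx

end DistributeGroup

end Literature.LinearAlgebra.BaseChange

end
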